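import Summits.AtomisticToContinuum.Crystallization.Theorems.OneCentreSteepnessLadderZeroDensityOfDefectsBookkeeping

/-!
# Route `OneCentreSteepnessLadder`, item `DominationEnergyLimit`: the lower bound from domination

Helper file for item stmt-AtomisticToContinuum-12887 (`DominationEnergyLimit`).  The NON-COERCIVE
clause of the route's one-centre domination template — for every `ε > 0` and `R₀` a radius
`R ≥ R₀` and a transfer rule `g`, antisymmetric on every `δ`-separated `S ⊂ ℝ³`, with
`Σ_{y ∈ S, |y−x| ≤ R} φ_q(|y−x|) + T_g(x) ≤ Φ + ε` at every `x ∈ S` (`φ_q(r) = 2r⁻ᵠ − r⁻²ᵠ`) —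
bounds the Mie energy of every finite `δ`-separated configuration of distinct points from below:

`𝓔_N(x) ≥ N · (−Φ/(4q) − β)` for every `β > 0` (`lowerBound`, `q ≥ 4`).

This is the domination bookkeeping of the sibling item `ZeroDensityOfDefects`
(`OneCentreSteepnessLadderZeroDensity.defect_count_le_of_transfer`: transfers cancel, truncation
costs `≤ 2048/(δ³R^{q−3})` per centre, `Σᵢ Σⱼ φ_q = −4q 𝓔`) read with the EMPTY defect
predicate, plus the choice `ε = 2qβ`, `R ≥ max(δ, 1, 1024/(q δ³ β))`.
All `[folklore]`; nothing here closes an item.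
-/

noncomputable section

namespace Summit.AtomisticToContinuum.Crystallization.Theorems.DominationEnergyLimit

open Literature.MathematicalPhysics.StatisticalMechanics
open Summit.AtomisticToContinuum.Crystallization.Theorems.OneCentreSteepnessLadderZeroDensity
open scoped BigOperators

/-- **The energetic lower bound from (non-coercive) one-centre domination.**  Let `q ≥ 4`,
`δ > 0`, `Φ ∈ ℝ`, and suppose that for every `ε > 0` and `R₀` there are `R ≥ R₀` and a rule
`g : ℝ³ → Set ℝ³ → ℝ` such that on every `δ`-separated `S ⊂ ℝ³` the transfers are antisymmetric,
`g(y − x, (S − x) ∩ B̄_R) = −g(x − y, (S − y) ∩ B̄_R)`, and every centre `x ∈ S` satisfies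
`Σ'_{y ∈ S} 1[|x−y| ≤ R] φ_q(|x−y|) + Σ'_{y ∈ S} g(y − x, (S − x) ∩ B̄_R) ≤ Φ + ε`.  Then for
every `β > 0` and every `δ`-separated configuration of `N` distinct points,
`N · (−Φ/(4q) − β) ≤ 𝓔_N(x)` for `V_q = miePotential q`. [folklore] -/
theorem lowerBound {q : ℕ} (hq : 4 ≤ q) {δ : ℝ} (hδ : 0 < δ) (Φ : ℝ)
    (hdom : ∀ ε : ℝ, 0 < ε → ∀ R₀ : ℝ, ∃ R : ℝ, R₀ ≤ R ∧
      ∃ g : EuclideanSpace ℝ (Fin 3) → Set (EuclideanSpace ℝ (Fin 3)) → ℝ,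
      ∀ S : Set (EuclideanSpace ℝ (Fin 3)), (∀ x ∈ S, ∀ y ∈ S, x ≠ y → δ ≤ dist x y) →
        (∀ x ∈ S, ∀ y ∈ S, g (y - x) (((fun z : EuclideanSpace ℝ (Fin 3) => z - x) '' S) ∩
            Metric.closedBall (0 : EuclideanSpace ℝ (Fin 3)) R) =
          - g (x - y) (((fun z : EuclideanSpace ℝ (Fin 3) => z - y) '' S) ∩
            Metric.closedBall (0 : EuclideanSpace ℝ (Fin 3)) R)) ∧
        ∀ x ∈ S, (∑' y : ↥S, (if dist x (y : EuclideanSpace ℝ (Fin 3)) ≤ R then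
            (2 * (dist x (y : EuclideanSpace ℝ (Fin 3)))⁻¹ ^ q -
              (dist x (y : EuclideanSpace ℝ (Fin 3)))⁻¹ ^ (2 * q)) else 0)) +
          (∑' y : ↥S, g ((y : EuclideanSpace ℝ (Fin 3)) - x)
            (((fun z : EuclideanSpace ℝ (Fin 3) => z - x) '' S) ∩
              Metric.closedBall (0 : EuclideanSpace ℝ (Fin 3)) R)) ≤ Φ + ε)
    {β : ℝ} (hβ : 0 < β) {N : ℕ} {x : Fin N → EuclideanSpace ℝ (Fin 3)}
    (hx : Function.Injective x)
    (hsep : ∀ i j : Fin N, i ≠ j → δ ≤ dist (x i) (x j)) :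
    (N : ℝ) * (-Φ / (4 * (q : ℝ)) - β) ≤ interactionEnergy (miePotential q) x := by
  classical
  have hqpos : (0 : ℝ) < q := by exact_mod_cast (show 0 < q by omega)
  -- choose `ε = 2qβ` and `R ≥ max δ 1, R ≥ 1024/(q δ³ β)`
  have hεpos : 0 < 2 * (q : ℝ) * β := by positivity
  obtain ⟨R, hR₀R, g, hS⟩ :=
    hdom (2 * (q : ℝ) * β) hεpos (max δ (max 1 (1024 / ((q : ℝ) * δ ^ 3 * β))))
  have hδR : δ ≤ R := (le_max_left _ _).trans hR₀R
  have h1R : 1 ≤ R := ((le_max_left _ _).trans (le_max_right _ _)).trans hR₀R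
  have hKR : 1024 / ((q : ℝ) * δ ^ 3 * β) ≤ R :=
    ((le_max_right _ _).trans (le_max_right _ _)).trans hR₀R
  have hRpos : 0 < R := hδ.trans_le hδR
  -- the template at the centres of `S = range x`
  have hSsep : ∀ p ∈ Set.range x, ∀ p' ∈ Set.range x, p ≠ p' → δ ≤ dist p p' := by
    rintro _ ⟨i, rfl⟩ _ ⟨j, rfl⟩ hne
    exact hsep i j fun h => hne (h ▸ rfl)
  obtain ⟨hanti, hpt⟩ := hS (Set.range x) hSsep
  -- the bookkeeping with the empty defect predicate
  have hbk := defect_count_le_of_transfer hq hδ hδR x hx hsep Φ (2 * (q : ℝ) * β) 0 g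
    (fun y => ((fun z : EuclideanSpace ℝ (Fin 3) => z - y) '' Set.range x) ∩
      Metric.closedBall (0 : EuclideanSpace ℝ (Fin 3)) R)
    (fun _ => False)
    (fun i j => hanti (x i) (Set.mem_range_self i) (x j) (Set.mem_range_self j))
    (fun i => hpt (x i) (Set.mem_range_self i)) (fun i hi => hi.elim)
  rw [zero_mul] at hbk
  -- the far field is `2qβ`-small: `2048/(δ³ R^{q-3}) ≤ 2qβ`
  have hN : (0 : ℝ) ≤ N := Nat.cast_nonneg N
  have hRq : R ≤ R ^ (q - 3) := by
    calc R = R ^ 1 := (pow_one R).symm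
      _ ≤ R ^ (q - 3) := pow_le_pow_right₀ h1R (by omega)
  have hτ_le : 2048 / (δ ^ 3 * R ^ (q - 3)) ≤ 2 * (q : ℝ) * β := by
    have h1 : 1024 ≤ (q : ℝ) * δ ^ 3 * β * R := by
      have := (div_le_iff₀ (by positivity : (0 : ℝ) < (q : ℝ) * δ ^ 3 * β)).1 hKR
      linarith
    have h2 : (q : ℝ) * δ ^ 3 * β * R ≤ (q : ℝ) * δ ^ 3 * β * R ^ (q - 3) :=
      mul_le_mul_of_nonneg_left hRq (by positivity)
    rw [div_le_iff₀ (by positivity : (0 : ℝ) < δ ^ 3 * R ^ (q - 3))]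
    nlinarith
  have hτN : (N : ℝ) * (2048 / (δ ^ 3 * R ^ (q - 3))) ≤ (N : ℝ) * (2 * (q : ℝ) * β) :=
    mul_le_mul_of_nonneg_left hτ_le hN
  -- conclude: `4q · N(−Φ/(4q) − β) = N(−Φ − 4qβ) ≤ 4q · 𝓔`
  have h4q : (0 : ℝ) < 4 * (q : ℝ) := by positivity
  refine le_of_mul_le_mul_left ?_ h4q
  have key : 4 * (q : ℝ) * ((N : ℝ) * (-Φ / (4 * (q : ℝ)) - β)) =
      -((N : ℝ) * Φ) - 2 * ((N : ℝ) * (2 * (q : ℝ) * β)) := by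
    field_simp
    ring
  rw [key]
  linarith

end Summit.AtomisticToContinuum.Crystallization.Theorems.DominationEnergyLimit

end
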